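import Summits.ValiantsHypothesis.ValiantsHypothesis.Theorems.BorderApolarityFixedWitnessObstructionQPIffGctThesis
import Summits.ValiantsHypothesis.ValiantsHypothesis.Theorems.BorderApolarityFixedWitnessObstructionQPReduction
import Summits.ValiantsHypothesis.ValiantsHypothesis.Theorems.BorderApolarityGctBridge

/-!
# Crux `FixedWitnessObstructionQP` (stmt-ValiantsHypothesis-5778): what the toric line must show, exactly

Route `ValiantsHypothesis/BorderApolarity`, crux item `stmt-ValiantsHypothesis-5778`, line
`toric-face-debordering` (registered skeleton: `FixedWitnessObstructionQP ⇐ stub_toricFaceMax ∧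
stub_toricDeborderQP ∧ stub_dcPerEventuallySuperQP`, composition
`…Reduction.fixedWitnessObstructionQP_of_toricFaceMax`).  Kernel-checked bookkeeping for the line
leads and the tenure planner; no new mathematics beyond one folklore lemma (initial forms of
translates are degenerations).

* `linSubst_weightedHomogeneousComponent_mem_orbitClosure` — **extremal weight components are
  degenerations**: if `e` bounds the `w`-weights of the monomials of `g · det_m`, then
  `u · wHC_w^e (g · det_m) ∈ Δ(det_m)` (it is the coefficientwise limit of the rescaled torus
  translates `(t+2)^{-e} · u · diag((t+2)^w) · g · det_m ∈ GL · det_m`, and Euclidean limits of orbit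
  points lie in the Zariski orbit closure).
* Hence the **J-free, topology-free form of the line's target**, called *NoExtremalInitialFormQP*
  below and always written out in full: "for every `c`, for all large `n` and every `m` in the
  window `n ≤ m ≤ 2^((log₂ n + c)^c)`, the padded permanent `X₀₀^(m-n) per_n` is NOT of the form
  `u · wHC_w^e (g · det_m)` with `⟨w, d⟩ ≤ e` on `supp (g · det_m)`" — i.e. the conclusion shape of
  the registered `stub_toricFaceMax` is never instantiated in the window.  Status, all by name:
  - `noExtremalInitialForm_of_gctThesis` / `…_of_fixedWitnessObstructionQP`: the thesis
    (stmt-0323), equivalently the crux, IMPLIES it — so no stub of the toric line whose failure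
    would produce such a representation in the window can be refuted without refuting the
    quasi-polynomial Mulmuley–Sohoni thesis;
  - `toricWitnessObstructionQP_of_noExtremalInitialForm`: it implies the toric child crux
    `ToricWitnessObstructionQP` (stmt-14753) with NO hypothesis (the extremal socle step
    `stub_socleMax`);
  - `fixedWitnessObstructionQP_iff_noExtremalInitialForm`, `noExtremalInitialForm_iff_gctThesis`:
    given the structural crux `ToricFixedPoints` (stmt-5779) it is EQUIVALENT to the crux and to
    the thesis — this is the exact residue of the toric line once 5779 is in;
  - `noExtremalInitialForm_of_toricDeborderQP`: the line's two remaining registered inputs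
    `stub_toricDeborderQP` (toric border ⇒ affine at quasi-polynomial cost) and
    `stub_dcPerEventuallySuperQP` (eventual super-quasi-polynomial `dc(per_n)`) imply it — the
    mathematical content of the line with `J`, `H₀` and all limits stripped.
* `dcPerEventuallySuperQP_of_gctThesis` / `…_of_fixedWitnessObstructionQP` — the registered
  external stub `stub_dcPerEventuallySuperQP` is **necessary**: it follows from the crux itself
  (attainment of `dc`, padding `HasDetRepr.mono`, Mulmuley–Sohoni 2001 Prop. 4.4, in the next
  window `c + 1`).  So of the line's three inputs, `stub_toricFaceMax` is carried by stmt-5779,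
  `stub_dcPerEventuallySuperQP` is implied by the target, and only `stub_toricDeborderQP` is a
  genuine strengthening (it quantifies over all `m ≥ n`, not over the window).
-/

open MvPolynomial Filter
open scoped BigOperators Matrix Topology
open Literature.Computability.AlgebraicComplexity
open Summit.ValiantsHypothesis.ValiantsHypothesis.Theses
open Summit.ValiantsHypothesis.ValiantsHypothesis.Theses.BorderApolarity

-- the mandated summit-side namespace `Summit.ValiantsHypothesis.ValiantsHypothesis.…`
-- (single-problem summit: summit name = problem name) repeats a component by design
set_option linter.dupNamespace false

namespace Summit.ValiantsHypothesis.ValiantsHypothesis.Theorems.BorderApolarityFixedWitnessObstructionQP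

/-! ## Initial forms of translates are degenerations -/

/-- Casting natural weights to integer weights commutes with `Finsupp.weight`. [folklore] -/
theorem weight_natCast_eq {σ : Type*} (w : σ → ℕ) (d : σ →₀ ℕ) :
    Finsupp.weight (fun i => (w i : ℤ)) d = ((Finsupp.weight w d : ℕ) : ℤ) := by
  simp only [Finsupp.weight_apply, Finsupp.sum, smul_eq_mul, nsmul_eq_mul, Nat.cast_sum,
    Nat.cast_mul]

/-- The top weight component written as a sum over the support: for integer weights cast from
`w : σ → ℕ`, `Σ_{d ∈ supp F} [⟨w,d⟩ = e] F_d x^d = wHC_w^e F`. [folklore] -/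
theorem sum_monomial_ite_weight_eq_weightedHomogeneousComponent {σ : Type*} [DecidableEq σ]
    (w : σ → ℕ) (e : ℕ) (F : MvPolynomial σ ℂ) :
    (∑ d ∈ F.support, monomial d
        (if Finsupp.weight (fun i => (w i : ℤ)) d = (e : ℤ) then coeff d F else 0)) =
      weightedHomogeneousComponent w e F := by
  classical
  ext d'
  rw [coeff_sum, coeff_weightedHomogeneousComponent]
  simp only [coeff_monomial]
  rw [Finset.sum_ite_eq']
  by_cases hd' : d' ∈ F.support
  · rw [if_pos hd', weight_natCast_eq]
    simp only [Nat.cast_inj]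
  · rw [if_neg hd']
    have h0 : coeff d' F = 0 := by simpa [mem_support_iff] using hd'
    rw [h0]
    split_ifs <;> rfl

/-- **Extremal weight components of translates of `det_m` are degenerations of `det_m`.**  If
`e` bounds the `w`-weight of every monomial of `F = g · det_m`, then for every `u ∈ GL_{m²}` the
translate `u · wHC_w^e(F)` of the top weight component (the `w`-initial form when the bound is
attained, `0` otherwise) lies in the orbit closure `Δ(det_m)`: it is the coefficientwise limit of
`(t+2)^{-e} · u · diag((t+2)^w) · g · det_m ∈ GL · det_m` (`Socle.tendsto_coeffVec_torus`,
`toricCurve_mem_glOrbit`, `smul_mem_glOrbit_detPoly`), and Euclidean limits of orbit points lie in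
the Zariski orbit closure (`mem_orbitClosure_of_tendsto`).  Mulmuley–Sohoni 2001 §4.2 (points of
`Δ` reached by one-parameter subgroups); Landsberg 2017 §6.7. [folklore] -/
theorem linSubst_weightedHomogeneousComponent_mem_orbitClosure {m : ℕ} [NeZero m]
    (u g : Matrix.GeneralLinearGroup (Fin m × Fin m) ℂ) (w : Fin m × Fin m → ℕ) (e : ℕ)
    (hmax : ∀ d ∈ (linSubst (Fin m × Fin m) ℂ (g : Matrix (Fin m × Fin m) (Fin m × Fin m) ℂ)
      (detPoly (Fin m) ℂ)).support, Finsupp.weight w d ≤ e) :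
    linSubst (Fin m × Fin m) ℂ (u : Matrix (Fin m × Fin m) (Fin m × Fin m) ℂ)
        (weightedHomogeneousComponent w e
          (linSubst (Fin m × Fin m) ℂ (g : Matrix (Fin m × Fin m) (Fin m × Fin m) ℂ)
            (detPoly (Fin m) ℂ))) ∈ orbitClosure (detPoly (Fin m) ℂ) := by
  set F : MvPolynomial (Fin m × Fin m) ℂ := linSubst (Fin m × Fin m) ℂ
    (g : Matrix (Fin m × Fin m) (Fin m × Fin m) ℂ) (detPoly (Fin m) ℂ) with hF
  set wz : Fin m × Fin m → ℤ := fun i => (w i : ℤ) with hwz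
  have hmax' : ∀ d ∈ F.support, Finsupp.weight wz d ≤ (e : ℤ) := fun d hd => by
    rw [hwz, weight_natCast_eq]
    exact_mod_cast hmax d hd
  -- the rescaled toric family and its coefficientwise limit
  have hlim := Socle.tendsto_coeffVec_torus (u : Matrix (Fin m × Fin m) (Fin m × Fin m) ℂ) F wz hmax'
  rw [sum_monomial_ite_weight_eq_weightedHomogeneousComponent] at hlim
  -- every member of the family is an orbit point
  have hQ : ∀ t : ℕ, ((((t : ℂ) + 2) ^ (-(e : ℤ))) •
      linSubst (Fin m × Fin m) ℂ (u : Matrix (Fin m × Fin m) (Fin m × Fin m) ℂ)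
        (linSubst (Fin m × Fin m) ℂ (Matrix.diagonal fun i => ((t : ℂ) + 2) ^ (wz i)) F)) ∈
      glOrbit (Fin m × Fin m) ℂ (detPoly (Fin m) ℂ) := fun t =>
    BorderApolarity.smul_mem_glOrbit_detPoly
      (Summit.ValiantsHypothesis.Cruxes.ToricFixedPoints.Negative.toricCurve_mem_glOrbit u g wz t)
      (zpow_ne_zero _ (BorderApolarityToricFixedPoints.tli_natCast_add_two_ne_zero t))
  exact BorderApolarity.mem_orbitClosure_of_tendsto (φ := fun t => t) _ hQ hlim

/-! ## The J-free target *NoExtremalInitialFormQP*: implied by the thesis, implies the toric child -/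

/-- **The thesis forbids extremal initial-form representations in the window.**  If
`GCTMult.GctThesis` (stmt-0323) holds then for every `c`, all large `n` and every `m` with
`n ≤ m ≤ 2^((log₂ n + c)^c)`, the padded permanent is not `u · wHC_w^e(g · det_m)` with `⟨w,d⟩ ≤ e`
on `supp(g · det_m)` — such a representation would put it in `Δ(det_m)`
(`linSubst_weightedHomogeneousComponent_mem_orbitClosure`). [folklore] -/
theorem noExtremalInitialForm_of_gctThesis (hG : GCTMult.GctThesis) :
    ∀ c : ℕ, ∃ n₀ : ℕ, ∀ n ≥ n₀, ∀ (m : ℕ) [NeZero m], n ≤ m → m ≤ 2 ^ ((Nat.log 2 n + c) ^ c) →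
      ¬ ∃ (u g : Matrix.GeneralLinearGroup (Fin m × Fin m) ℂ) (w : Fin m × Fin m → ℕ) (e : ℕ),
        (∀ d ∈ (linSubst (Fin m × Fin m) ℂ (g : Matrix (Fin m × Fin m) (Fin m × Fin m) ℂ)
          (detPoly (Fin m) ℂ)).support, Finsupp.weight w d ≤ e) ∧
        paddedPerPoly ℂ n m =
          linSubst (Fin m × Fin m) ℂ (u : Matrix (Fin m × Fin m) (Fin m × Fin m) ℂ)
            (MvPolynomial.weightedHomogeneousComponent w e
              (linSubst (Fin m × Fin m) ℂ (g : Matrix (Fin m × Fin m) (Fin m × Fin m) ℂ)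
                (detPoly (Fin m) ℂ))) := by
  intro c
  obtain ⟨n₀, hn₀⟩ := hG c
  refine ⟨n₀, fun n hn m _ hnm hm => ?_⟩
  rintro ⟨u, g, w, e, hmax, hpp⟩
  have hmem := linSubst_weightedHomogeneousComponent_mem_orbitClosure u g w e hmax
  rw [← hpp] at hmem
  exact hn₀ n hn m hnm hm hmem

/-- **The crux forbids extremal initial-form representations in the window** (the crux is the
thesis, `gctThesis_of_fixedWitnessObstructionQP`).  In the registered skeleton of line
`toric-face-debordering` this says: under the target, the conclusion of `stub_toricFaceMax` is never
instantiated inside the window. [folklore] -/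
theorem noExtremalInitialForm_of_fixedWitnessObstructionQP (hX : FixedWitnessObstructionQP) :
    ∀ c : ℕ, ∃ n₀ : ℕ, ∀ n ≥ n₀, ∀ (m : ℕ) [NeZero m], n ≤ m → m ≤ 2 ^ ((Nat.log 2 n + c) ^ c) →
      ¬ ∃ (u g : Matrix.GeneralLinearGroup (Fin m × Fin m) ℂ) (w : Fin m × Fin m → ℕ) (e : ℕ),
        (∀ d ∈ (linSubst (Fin m × Fin m) ℂ (g : Matrix (Fin m × Fin m) (Fin m × Fin m) ℂ)
          (detPoly (Fin m) ℂ)).support, Finsupp.weight w d ≤ e) ∧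
        paddedPerPoly ℂ n m =
          linSubst (Fin m × Fin m) ℂ (u : Matrix (Fin m × Fin m) (Fin m × Fin m) ℂ)
            (MvPolynomial.weightedHomogeneousComponent w e
              (linSubst (Fin m × Fin m) ℂ (g : Matrix (Fin m × Fin m) (Fin m × Fin m) ℂ)
                (detPoly (Fin m) ℂ))) :=
  noExtremalInitialForm_of_gctThesis (gctThesis_of_fixedWitnessObstructionQP hX)

/-- **No extremal initial form ⟹ the toric child crux** `ToricWitnessObstructionQP` (stmt-14753),
with NO hypothesis: a toric witness `(u, g, w, J)` at `(n, m)`, `3 ≤ n ≤ m`, yields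
`pp = u' · wHC_{w'}^{e'}(g' · det_m)` with `e'` extremal by the landed extremal socle step
`stub_socleMax` (only W2/W3 and W5 are used; the `H₀`-stability clause is idle).  Threshold
`max n₀ 3`. [folklore] -/
theorem toricWitnessObstructionQP_of_noExtremalInitialForm
    (hN : ∀ c : ℕ, ∃ n₀ : ℕ, ∀ n ≥ n₀, ∀ (m : ℕ) [NeZero m], n ≤ m →
      m ≤ 2 ^ ((Nat.log 2 n + c) ^ c) →
      ¬ ∃ (u g : Matrix.GeneralLinearGroup (Fin m × Fin m) ℂ) (w : Fin m × Fin m → ℕ) (e : ℕ),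
        (∀ d ∈ (linSubst (Fin m × Fin m) ℂ (g : Matrix (Fin m × Fin m) (Fin m × Fin m) ℂ)
          (detPoly (Fin m) ℂ)).support, Finsupp.weight w d ≤ e) ∧
        paddedPerPoly ℂ n m =
          linSubst (Fin m × Fin m) ℂ (u : Matrix (Fin m × Fin m) (Fin m × Fin m) ℂ)
            (MvPolynomial.weightedHomogeneousComponent w e
              (linSubst (Fin m × Fin m) ℂ (g : Matrix (Fin m × Fin m) (Fin m × Fin m) ℂ)
                (detPoly (Fin m) ℂ)))) :
    ToricWitnessObstructionQP := by
  intro c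
  obtain ⟨n₀, hn₀⟩ := hN c
  refine ⟨max n₀ 3, ?_⟩
  intro n hn m inst hnm hm
  have h3 : 3 ≤ n := le_trans (le_max_right n₀ 3) hn
  have hn' : n₀ ≤ n := le_trans (le_max_left n₀ 3) hn
  have hS := @stub_socleMax n m inst h3 hnm
  have hNn := @hn₀ n hn' m inst hnm hm
  simp only [] at hS ⊢
  rintro ⟨u, g, w, J, hlo, hup, hstab, hpp⟩
  exact hNn (hS J u g w ⟨hlo, hup⟩ hpp)

/-- Given the structural crux `ToricFixedPoints` (stmt-5779), **no extremal initial form ⟹ the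
crux** (through the toric child and the glue `fixedWitnessObstructionQP_of_toric`). [folklore] -/
theorem fixedWitnessObstructionQP_of_noExtremalInitialForm (hT : ToricFixedPoints)
    (hN : ∀ c : ℕ, ∃ n₀ : ℕ, ∀ n ≥ n₀, ∀ (m : ℕ) [NeZero m], n ≤ m →
      m ≤ 2 ^ ((Nat.log 2 n + c) ^ c) →
      ¬ ∃ (u g : Matrix.GeneralLinearGroup (Fin m × Fin m) ℂ) (w : Fin m × Fin m → ℕ) (e : ℕ),
        (∀ d ∈ (linSubst (Fin m × Fin m) ℂ (g : Matrix (Fin m × Fin m) (Fin m × Fin m) ℂ)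
          (detPoly (Fin m) ℂ)).support, Finsupp.weight w d ≤ e) ∧
        paddedPerPoly ℂ n m =
          linSubst (Fin m × Fin m) ℂ (u : Matrix (Fin m × Fin m) (Fin m × Fin m) ℂ)
            (MvPolynomial.weightedHomogeneousComponent w e
              (linSubst (Fin m × Fin m) ℂ (g : Matrix (Fin m × Fin m) (Fin m × Fin m) ℂ)
                (detPoly (Fin m) ℂ)))) :
    FixedWitnessObstructionQP :=
  fixedWitnessObstructionQP_of_toric hT (toricWitnessObstructionQP_of_noExtremalInitialForm hN)

/-- **The exact residue of the toric line, given stmt-5779**: `ToricFixedPoints` makes the crux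
EQUIVALENT to "no extremal initial-form representation of the padded permanent in the
quasi-polynomial window". [folklore] -/
theorem fixedWitnessObstructionQP_iff_noExtremalInitialForm (hT : ToricFixedPoints) :
    FixedWitnessObstructionQP ↔
    ∀ c : ℕ, ∃ n₀ : ℕ, ∀ n ≥ n₀, ∀ (m : ℕ) [NeZero m], n ≤ m → m ≤ 2 ^ ((Nat.log 2 n + c) ^ c) →
      ¬ ∃ (u g : Matrix.GeneralLinearGroup (Fin m × Fin m) ℂ) (w : Fin m × Fin m → ℕ) (e : ℕ),
        (∀ d ∈ (linSubst (Fin m × Fin m) ℂ (g : Matrix (Fin m × Fin m) (Fin m × Fin m) ℂ)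
          (detPoly (Fin m) ℂ)).support, Finsupp.weight w d ≤ e) ∧
        paddedPerPoly ℂ n m =
          linSubst (Fin m × Fin m) ℂ (u : Matrix (Fin m × Fin m) (Fin m × Fin m) ℂ)
            (MvPolynomial.weightedHomogeneousComponent w e
              (linSubst (Fin m × Fin m) ℂ (g : Matrix (Fin m × Fin m) (Fin m × Fin m) ℂ)
                (detPoly (Fin m) ℂ))) :=
  ⟨noExtremalInitialForm_of_fixedWitnessObstructionQP,
    fixedWitnessObstructionQP_of_noExtremalInitialForm hT⟩

/-- Given `ToricFixedPoints` (stmt-5779), "no extremal initial form in the window" is likewise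
EQUIVALENT to the quasi-polynomial Mulmuley–Sohoni thesis `GCTMult.GctThesis` (stmt-0323).
[folklore] -/
theorem noExtremalInitialForm_iff_gctThesis (hT : ToricFixedPoints) :
    (∀ c : ℕ, ∃ n₀ : ℕ, ∀ n ≥ n₀, ∀ (m : ℕ) [NeZero m], n ≤ m → m ≤ 2 ^ ((Nat.log 2 n + c) ^ c) →
      ¬ ∃ (u g : Matrix.GeneralLinearGroup (Fin m × Fin m) ℂ) (w : Fin m × Fin m → ℕ) (e : ℕ),
        (∀ d ∈ (linSubst (Fin m × Fin m) ℂ (g : Matrix (Fin m × Fin m) (Fin m × Fin m) ℂ)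
          (detPoly (Fin m) ℂ)).support, Finsupp.weight w d ≤ e) ∧
        paddedPerPoly ℂ n m =
          linSubst (Fin m × Fin m) ℂ (u : Matrix (Fin m × Fin m) (Fin m × Fin m) ℂ)
            (MvPolynomial.weightedHomogeneousComponent w e
              (linSubst (Fin m × Fin m) ℂ (g : Matrix (Fin m × Fin m) (Fin m × Fin m) ℂ)
                (detPoly (Fin m) ℂ)))) ↔
    GCTMult.GctThesis :=
  ⟨fun hN => gctThesis_of_fixedWitnessObstructionQP
      (fixedWitnessObstructionQP_of_noExtremalInitialForm hT hN),
    noExtremalInitialForm_of_gctThesis⟩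

/-! ## The line's content with `J`, `H₀` and all limits stripped -/

/-- **`ToricDeborderQP ∧ eventual super-qp dc(per_n) ⟹ no extremal initial form in the window`**:
the two registered open inputs of line `toric-face-debordering` other than `stub_toricFaceMax`
(`hTD = stub_toricDeborderQP`, `hdc = stub_dcPerEventuallySuperQP`, verbatim) already give the
J-free target; given `c`, take `c'` from `qp_absorb c c₁ 1 1` and `n₀ := max n₁ 3` with `n₁` from
`hdc c'`: a representation at `(n, m)` in the window gives
`dc(per_n) ≤ 2^((log₂ m + c₁)^c₁) ≤ 2^((log₂ n + c')^c') < dc(per_n)`.  Same arithmetic as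
`fixedWitnessObstructionQP_of_toricFaceMax`. [folklore] -/
theorem noExtremalInitialForm_of_toricDeborderQP
    (hTD : ∃ c₁ : ℕ, ∀ (n m : ℕ) [NeZero m], 3 ≤ n → n ≤ m →
    (∃ (u g : Matrix.GeneralLinearGroup (Fin m × Fin m) ℂ) (w : Fin m × Fin m → ℕ) (e : ℕ),
        (∀ d ∈ (linSubst (Fin m × Fin m) ℂ (g : Matrix (Fin m × Fin m) (Fin m × Fin m) ℂ) (detPoly (Fin m) ℂ)).support,
          Finsupp.weight w d ≤ e) ∧
        paddedPerPoly ℂ n m =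
          linSubst (Fin m × Fin m) ℂ (u : Matrix (Fin m × Fin m) (Fin m × Fin m) ℂ)
            (MvPolynomial.weightedHomogeneousComponent w e
              (linSubst (Fin m × Fin m) ℂ (g : Matrix (Fin m × Fin m) (Fin m × Fin m) ℂ) (detPoly (Fin m) ℂ)))) →
      determinantalComplexity (perPoly (Fin n) ℂ) ≤ 2 ^ ((Nat.log 2 m + c₁) ^ c₁))
    (hdc : ∀ c : ℕ, ∃ n₀ : ℕ, ∀ n ≥ n₀,
    2 ^ ((Nat.log 2 n + c) ^ c) < determinantalComplexity (perPoly (Fin n) ℂ)) :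
    ∀ c : ℕ, ∃ n₀ : ℕ, ∀ n ≥ n₀, ∀ (m : ℕ) [NeZero m], n ≤ m → m ≤ 2 ^ ((Nat.log 2 n + c) ^ c) →
      ¬ ∃ (u g : Matrix.GeneralLinearGroup (Fin m × Fin m) ℂ) (w : Fin m × Fin m → ℕ) (e : ℕ),
        (∀ d ∈ (linSubst (Fin m × Fin m) ℂ (g : Matrix (Fin m × Fin m) (Fin m × Fin m) ℂ)
          (detPoly (Fin m) ℂ)).support, Finsupp.weight w d ≤ e) ∧
        paddedPerPoly ℂ n m =
          linSubst (Fin m × Fin m) ℂ (u : Matrix (Fin m × Fin m) (Fin m × Fin m) ℂ)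
            (MvPolynomial.weightedHomogeneousComponent w e
              (linSubst (Fin m × Fin m) ℂ (g : Matrix (Fin m × Fin m) (Fin m × Fin m) ℂ)
                (detPoly (Fin m) ℂ))) := by
  obtain ⟨c₁, hTD⟩ := hTD
  intro c
  obtain ⟨c', hc'⟩ := qp_absorb c c₁ 1 1
  obtain ⟨n₁, hn₁⟩ := hdc c'
  refine ⟨max n₁ 3, ?_⟩
  intro n hn m inst hnm hm hw
  have h3 : 3 ≤ n := le_trans (le_max_right _ _) hn
  have hn₁' : n₁ ≤ n := le_trans (le_max_left _ _) hn
  have hdc' := @hTD n m inst h3 hnm hw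
  have hle := hc' n m hm
  have hlt := hn₁ n hn₁'
  have hB : 2 ^ ((Nat.log 2 m + c₁) ^ c₁) ≤
      1 * ((m + 1) * (2 ^ ((Nat.log 2 m + c₁) ^ c₁) + 1)) ^ 1 := by
    rw [one_mul, pow_one]
    nlinarith [Nat.zero_le m, Nat.zero_le (2 ^ ((Nat.log 2 m + c₁) ^ c₁))]
  exact (lt_irrefl _ (hlt.trans_le ((hdc'.trans hB).trans hle))).elim

/-! ## The external stub is necessary -/

/-- **The thesis implies EVENTUAL super-quasi-polynomial `dc(per_n)`** — the registered external
stub `stub_dcPerEventuallySuperQP` of line `toric-face-debordering`, verbatim, is a COROLLARY of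
`GCTMult.GctThesis` (stmt-0323): given `c`, take `n₀ := max n₀(c+1) 1`; if
`dc(per_n) ≤ 2^((log₂ n + c)^c)` for some `n ≥ n₀`, then with `m := max (dc per_n) n` one has
`n ≤ m ≤ 2^((log₂ n + (c+1))^(c+1))` (`le_two_pow_log_add_succ_pow`), an affine determinantal
representation of `per_n` of size `m` (attainment `hasDetRepr_determinantalComplexity_holds`, padding
`HasDetRepr.mono_holds`), hence `X₀₀^(m-n) per_n ∈ Δ(det_m)` by Mulmuley–Sohoni 2001 Prop. 4.4
(`paddedPerPoly_mem_orbitClosure_detPoly_of_hasDetRepr_holds`), contradicting the thesis at `c + 1`.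
The eventual (`∀ n ≥ n₀`) form, as opposed to the infinitely-often form
`BorderApolarityGctBridge.not_isQPBounded_dc_per_of_thesis`. [folklore] -/
theorem dcPerEventuallySuperQP_of_gctThesis (hG : GCTMult.GctThesis) :
    ∀ c : ℕ, ∃ n₀ : ℕ, ∀ n ≥ n₀,
      2 ^ ((Nat.log 2 n + c) ^ c) < determinantalComplexity (perPoly (Fin n) ℂ) := by
  intro c
  obtain ⟨n₀, hn₀⟩ := hG (c + 1)
  refine ⟨max n₀ 1, fun n hn => ?_⟩
  have hn₀' : n₀ ≤ n := le_trans (le_max_left _ _) hn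
  have hn1 : 1 ≤ n := le_trans (le_max_right _ _) hn
  by_contra hle
  push Not at hle
  set t := determinantalComplexity (perPoly (Fin n) ℂ) with ht
  set m := max t n with hm
  haveI : NeZero m := NeZero.of_pos (by omega)
  have hnm : n ≤ m := le_max_right _ _
  have htm : t ≤ m := le_max_left _ _
  have hbound : m ≤ 2 ^ ((Nat.log 2 n + (c + 1)) ^ (c + 1)) := by
    have h1 : t ≤ 2 ^ ((Nat.log 2 n + (c + 1)) ^ (c + 1)) :=
      hle.trans (Nat.pow_le_pow_right (by norm_num)
        (BorderApolarityGctBridge.add_pow_le_add_succ_pow_succ _ _))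
    have h2 : n ≤ 2 ^ ((Nat.log 2 n + (c + 1)) ^ (c + 1)) :=
      BorderApolarityGctBridge.le_two_pow_log_add_succ_pow n c
    exact max_le h1 h2
  have hrep : HasDetRepr (perPoly (Fin n) ℂ) m :=
    HasDetRepr.mono_holds (hasDetRepr_determinantalComplexity_holds _) htm
  exact hn₀ n hn₀' m hnm hbound
    (paddedPerPoly_mem_orbitClosure_detPoly_of_hasDetRepr_holds hrep hnm)

/-- **The registered external stub `stub_dcPerEventuallySuperQP` is necessary for the crux**: it
follows from `FixedWitnessObstructionQP` itself (the crux is the thesis). [folklore] -/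
theorem dcPerEventuallySuperQP_of_fixedWitnessObstructionQP (hX : FixedWitnessObstructionQP) :
    ∀ c : ℕ, ∃ n₀ : ℕ, ∀ n ≥ n₀,
      2 ^ ((Nat.log 2 n + c) ^ c) < determinantalComplexity (perPoly (Fin n) ℂ) :=
  dcPerEventuallySuperQP_of_gctThesis (gctThesis_of_fixedWitnessObstructionQP hX)

end Summit.ValiantsHypothesis.ValiantsHypothesis.Theorems.BorderApolarityFixedWitnessObstructionQP
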